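import Summits.ResolutionOfSingularities.ResolutionOfSingularities.Theses.UniversalCells
import Summits.ResolutionOfSingularities.ResolutionOfSingularities.Theorems.UniversalCellsLocalToGlobalHSTowerDefs
import Summits.ResolutionOfSingularities.ResolutionOfSingularities.Theorems.UniversalCellsLocalToGlobalStepRegularOverRegular
import Summits.ResolutionOfSingularities.ResolutionOfSingularities.Theorems.UniversalCellsLocalToGlobalIsOpenResolvedOver
import Summits.ResolutionOfSingularities.ResolutionOfSingularities.Theorems.UniversalCellsLocalToGlobalExistsStageOfPointwise
import Summits.ResolutionOfSingularities.ResolutionOfSingularities.Theorems.UniversalCellsLocalToGlobalHasResolutionOfIsRegularIter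
import Summits.ResolutionOfSingularities.ResolutionOfSingularities.Theorems.UniversalCellsLocalToGlobalReduceToNormalization
import Summits.ResolutionOfSingularities.ResolutionOfSingularities.Theorems.UniversalCellsLocalToGlobalOfHSTransfer
import Literature.AlgebraicGeometry.Resolution.LipmanProcedure
import Literature.AlgebraicGeometry.Resolution.HilbertSamuelStrata
import Literature.AlgebraicGeometry.Resolution.SurfaceResolutionReduction
import Literature.AlgebraicGeometry.Resolution.AlterationsNormalizationReduction
import Literature.AlgebraicGeometry.Resolution.AlterationsStrong
import Mathlib.Order.PiLex
import HarnessLib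

/-!
# `LocalToGlobal` (crux stmt-ResolutionOfSingularities-15232, route UniversalCells) — line `Sketch`
(idea `existence-certified-termination`), LEAD SKELETON (lead a1, 2026-08-17)

**Crux.** `LocalToGlobal : ∀ p prime, H_p → R_p`: if every point of every integral separated
finite-type `𝔽_p`-scheme has an open neighbourhood with a resolution, then every such scheme
has a resolution.

**Line (glue nothing).** Fix `N`. For a normal variety `V` over a field let
`V = V₀ ← V₁ ← V₂ ← ⋯` be the BLIND TOWER `V_{i+1} := (Bl_{Z_i} V_i)^ν`, where `Z_i` is the
REDUCED closed subscheme on `closure {x | H^N_{V_i}(x) is lex-maximal} ∩ Sing V_i` (`H^N` =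
Cossart–Jannsen–Saito's Hilbert–Samuel function `Scheme.hsFun`, compared in the LEXICOGRAPHIC
order; the step is `NormalVariety.step`, built on the tree's `blowup` / `normalization` exactly
like `lipmanStep`). The ATOM `stub_hsTransfer` says: if every point of `V` has an open
neighbourhood with a resolution, the tower is eventually regular over every point of `V`
(Zariski 1939 / Lipman 1978: "a desingularization exists ⇒ the canonical sequence is finite",
transferred from dimension 2). Everything else is bookkeeping: the step is an isomorphism over
the regular locus (`stub_step_regular_over_regular`), the resolved-over locus of each stage is
open (`stub_isOpen_resolvedOver`), so by quasi-compactness some stage is regular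
(`stub_exists_stage_of_pointwise`), a regular stage is a resolution of `V` (`stub_hasResolution_of_isRegular_iter`),
and `X` is replaced by its normalization (`stub_reduce_to_normalization`). Composition:
`LocalToGlobal_of` (sorry-free modulo the stubs) concludes the crux BY NAME.

Stubs: `stub_hsTransfer` (ATOM — the only `sorry` left); LANDED and imported: `stub_hsTowerDefs`
(p165041, Defs), `stub_step_regular_over_regular` (p165613), `stub_isOpen_resolvedOver` (p165638),
`stub_exists_stage_of_pointwise` (p165615), `stub_hasResolution_of_isRegular_iter` (p165585),
`stub_reduce_to_normalization` (p165617), and the certificate `stub_localToGlobal_of_hsTransfer`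
(ATOM ⇒ crux, p167406), through which the composition below now runs.

The objects (`hsLexMaxLocus`, `hsCentre`, `hsCentreIdeal`, `hsBlowup`, `hsStep`, `NormalVariety`,
`NormalVariety.step/stepπ/iterπ/IsResolvedOver`) live in the LANDED Defs file
`Theorems/UniversalCellsLocalToGlobalHSTowerDefs.lean` (p165041), imported here.
-/

set_option linter.dupNamespace false -- mandated namespace of this single-conjunct summit

noncomputable section

open CategoryTheory AlgebraicGeometry TopologicalSpace Topology
open AlgebraicGeometry.Scheme.IdealSheafData
open Literature.AlgebraicGeometry.Resolution

namespace Summit.ResolutionOfSingularities.ResolutionOfSingularities.Theorems.LocalToGlobal.HSTower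

/-! ## Stubs -/
-- `stub_hsTowerDefs` (definitional glue): LANDED in the Defs file (p165041), imported above.
/-- **ATOM `HSTransfer` — REFUTED 2026-08-17 (lead a1, cycle 2): FALSE for every prime `p`.**
Witness: the normal affine toric 5-fold `U_{σ*}`, `σ* = cone{(−29,−23,−11,34,−17), (−14,−11,−6,17,−8),
(−9,−8,−6,15,−7), (−4,−5,−3,6,−3), (−3,−4,−2,5,−3), (−3,−3,−1,2,−1), (−3,5,3,0,1)} ⊂ ℤ⁵`, `N = 6`,
`x` = the fixed point: the lex-max HS locus is `{x}` (HS `(1,11,47,136,…)`), and the normalized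
blow-up of `𝔪_x` has a chart `U_{Aσ*}`, `A = I − (5,4,2,−6,3) ⊗ (4,−5,9,8,10)` unipotent, all other
charts and faces strictly HS-smaller — the tower reproduces the singularity over `x` forever
(`Cruxes/LocalToGlobal/LexHSBlindTowerLoopsDim5.md`, independently verified). The line is dead at
this stub; the `sorry` below can never be filled. Original docstring:
(existence-certified termination; Zariski 1939 / Lipman 1978 in dimension 2, OPEN in dimension ≥ 3).** For a normal variety `V` over `𝔽_p` with `dim V < N`
every point of which has an open neighbourhood admitting a resolution, the blind lex-maximal
Hilbert–Samuel tower of `V` is regular over every point of `V` at some stage. Refutable by a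
LOOP (e.g. a toric normal variety — always locally resolvable — whose tower reproduces a
singular chart forever). [cite: Lipman1978, §2; Zariski1939] -/
theorem stub_hsTransfer (p : ℕ) [Fact p.Prime] (V : NormalVariety (ZMod p)) (N : ℕ)
    (hN : topologicalKrullDim V.X < (N : WithBot ℕ∞))
    (hloc : ∀ x : V.X, ∃ U : V.X.Opens, x ∈ U ∧ Scheme.HasResolution (U : Scheme.{0}))
    (x : V.X) : ∃ n : ℕ, V.IsResolvedOver N n x := by
  sorry
-- `stub_localToGlobal_of_hsTransfer` (certificate ATOM ⇒ crux): LANDED (p167406), imported above.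
-- `stub_step_regular_over_regular`: LANDED (p165613), imported above.
-- `stub_isOpen_resolvedOver`: LANDED (p165638), imported above.
-- `stub_exists_stage_of_pointwise`: LANDED (p165615), imported above.
-- `stub_hasResolution_of_isRegular_iter`: LANDED (p165585), imported above.
-- `stub_reduce_to_normalization`: LANDED (p165617), imported above.

/-! ## Composition -/

/-- **Composition: the stubs imply the crux `LocalToGlobal` BY NAME** — the landed certificate
`stub_localToGlobal_of_hsTransfer` (p167406: normalize, atom, monotone open exhaustion of the
quasi-compact `V`, a regular stage is a resolution; every bookkeeping stub landed) fed with the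
ATOM `stub_hsTransfer`. [folklore] -/
theorem LocalToGlobal_of :
    Summit.ResolutionOfSingularities.ResolutionOfSingularities.Theses.UniversalCells.LocalToGlobal :=
  stub_localToGlobal_of_hsTransfer fun p _ V N hN hloc x => stub_hsTransfer p V N hN hloc x

/-- The crux, closed modulo the ATOM (the form the gate probes: literally the route decl). -/
theorem LocalToGlobal_proof :
    Summit.ResolutionOfSingularities.ResolutionOfSingularities.Theses.UniversalCells.LocalToGlobal :=
  LocalToGlobal_of

end Summit.ResolutionOfSingularities.ResolutionOfSingularities.Theorems.LocalToGlobal.HSTower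

end
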